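import Mathlib
import Summits.CriticalPhenomena.PercolationContinuityZ3.Theorems.PercNearOneGluingNoHeavyLowerTailOrderedDifferencesQuadraticReduction

/-!
# Finite-field certificates for quadratic unit classes: discharging the hypotheses of LEMMA R_p

Helper file for crux `stmt-CriticalPhenomena-4575` (`NoHeavyLowerTail`, route `PercNearOneGluingNoHeavy`), new-inequality factory
seat `prim-ineq-gen-3` (gen 28).  Everything here is PROVED; no definitions.

`…OrderedDifferencesQuadraticReduction.linearIndependent_pencil_quad_of_reduction` transfers independence of the Marica–Schönheim
pencil rows at `θ` (a root of `X² = uX + v` in a field `F`, with `a + bθ = 0 ⟹ p ∣ a, p ∣ b`) to independence at `t` (a root of the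
same quadratic in a field `K` in which `1, t` are independent over `ℤ`).  This file discharges the two side hypotheses once and for all:

* `int_indep_of_quad_no_int_root` — if `X² − uX − v` has no INTEGER root then `1, t` are `ℤ`-independent in any field of characteristic
  `0` (rational root theorem for a monic quadratic, by a gcd argument);
* `dvd_of_quad_no_root_mod` — if `X² − uX − v` has no root in `ZMod p` (`p` prime; a `decide`-able fact) then in any field `F` of
  characteristic `p`, `a + bθ = 0` forces `p ∣ a` and `p ∣ b`;
* `linearIndependent_pencil_quad_of_finite_certificate` — ★ the packaged transfer: no integer root + no root mod `p` + independence at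
  `θ ∈ F` (char `p`) ⟹ independence at `t ∈ K` (char `0`);
* instances (each a few lines): `…_silver_of_charThree` (`t² = 2t + 1`, `𝔽₉`), `…_phiSq_of_charTwo` and `…_phiSq_of_charThree`
  (`t² = 3t − 1`), `…_imagUnit_of_charThree` (`t² = −1`, `𝔽₉`), `…_sqrt21_of_charTwo` (`t² = 5t − 1`, `𝔽₄`), `…_twoSqrt3_of_charFive`
  (`t² = 4t − 1`, `𝔽₂₅`), `…_cubeRootUnity_of_charTwo` (`t² = −t − 1`, `𝔽₄`: `ζ₃`), `…_sixthRootUnity_of_charTwo` (`t² = t − 1`: `ζ₆`).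
So for each of these classes a machine check 'rank_{𝔽_q} U(θ) = |𝒜|' is, by a Lean theorem, a certificate of (C0) at that class for `𝒜`.
(prim-ineq-gen-3 gen 28, 2026-08-25.)
-/

namespace Summit.CriticalPhenomena.PercolationContinuityZ3.Theorems

namespace OrderedDifferences

open Finset
open scoped FinsetFamily

variable {α : Type*} [DecidableEq α]

/-- **Rational root theorem, monic quadratic.**  If `X² = uX + v` has no integer root, then `a + b t = 0` (`a b : ℤ`) with
`t * t = u t + v` in a field of characteristic `0` forces `a = b = 0`. -/
theorem int_indep_of_quad_no_int_root {K : Type*} [Field K] [CharZero K] (u v : ℤ) {t : K}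
    (ht : t * t = (u : K) * t + (v : K)) (hno : ∀ n : ℤ, n * n ≠ u * n + v)
    (a b : ℤ) (h : (a : K) + (b : K) * t = 0) : a = 0 ∧ b = 0 := by
  by_cases hb : b = 0
  · subst hb
    have : (a : K) = 0 := by simpa using h
    exact ⟨Int.cast_eq_zero.mp this, rfl⟩
  exfalso
  have ha : (a : K) = -((b : K) * t) := by linear_combination h
  have eK : ((a * a + u * a * b - v * b * b : ℤ) : K) = 0 := by
    push_cast
    rw [ha]
    linear_combination ((b : K) * b) * ht
  have e : a * a + u * a * b - v * b * b = 0 := Int.cast_eq_zero.mp eK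
  -- divide by the gcd
  set d : ℤ := (Int.gcd a b : ℤ) with hd
  have hdpos : 0 < Int.gcd a b := Int.gcd_pos_of_ne_zero_right a hb
  have hd0 : d ≠ 0 := by rw [hd]; exact_mod_cast hdpos.ne'
  obtain ⟨a', ha'⟩ : (d : ℤ) ∣ a := Int.gcd_dvd_left a b
  obtain ⟨b', hb'⟩ : (d : ℤ) ∣ b := Int.gcd_dvd_right a b
  have hcop : Int.gcd a' b' = 1 := by
    have h1 : Int.gcd a b = Int.gcd (d * a') (d * b') := by rw [← ha', ← hb']
    rw [Int.gcd_mul_left, Int.natAbs_natCast] at h1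
    -- h1 : gcd a b = gcd a b * gcd a' b'
    have : Int.gcd a b * Int.gcd a' b' = Int.gcd a b * 1 := by rw [mul_one]; exact h1.symm
    exact Nat.eq_of_mul_eq_mul_left hdpos this
  have e' : a' * a' + u * a' * b' - v * b' * b' = 0 := by
    have : d * d * (a' * a' + u * a' * b' - v * b' * b') = 0 := by
      rw [ha', hb'] at e; linear_combination e
    rcases mul_eq_zero.mp this with h0 | h0
    · exact absurd (mul_self_eq_zero.mp h0) hd0
    · exact h0
  have hb'0 : b' ≠ 0 := by rintro rfl; apply hb; rw [hb']; ring
  -- b' divides a'^2, hence b' = ±1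
  have hcopr : IsCoprime b' a' := by
    rw [Int.isCoprime_iff_gcd_eq_one, Int.gcd_comm]; exact hcop
  have hdiv : b' ∣ a' * a' := ⟨-(u * a') + v * b', by linear_combination e'⟩
  have hdiv1 : b' ∣ a' := hcopr.dvd_of_dvd_mul_left hdiv
  have hunit : IsUnit b' := by
    have : b' ∣ 1 := by
      have h1 : (Int.gcd b' a' : ℤ) = 1 := by rw [Int.gcd_comm]; exact_mod_cast hcop
      rw [← h1]
      exact Int.dvd_coe_gcd (dvd_refl b') hdiv1
    exact isUnit_of_dvd_one this
  rcases Int.isUnit_iff.mp hunit with h1 | h1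
  · apply hno (-a')
    rw [h1] at e'
    linear_combination e'
  · apply hno a'
    rw [h1] at e'
    linear_combination e'

/-- **No root modulo `p` ⟹ `θ` is not in the prime field.**  If `X² = uX + v` has no root in `ZMod p` (`p` prime) and
`θ * θ = u θ + v` in a field `F` of characteristic `p`, then `a + b θ = 0` (`a b : ℤ`) forces `p ∣ a` and `p ∣ b`. -/
theorem dvd_of_quad_no_root_mod {F : Type*} [Field F] (p : ℕ) [Fact p.Prime] [CharP F p] (u v : ℤ) {θ : F}
    (hθ : θ * θ = (u : F) * θ + (v : F)) (hno : ∀ r : ZMod p, r * r ≠ (u : ZMod p) * r + (v : ZMod p))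
    (a b : ℤ) (h : (a : F) + (b : F) * θ = 0) : (p : ℤ) ∣ a ∧ (p : ℤ) ∣ b := by
  let ι : ZMod p →+* F := ZMod.castHom (dvd_refl p) F
  have hι : Function.Injective ι := ι.injective
  have ha : (a : F) = ι (a : ZMod p) := by simp
  have hb : (b : F) = ι (b : ZMod p) := by simp
  rw [ha, hb] at h
  by_cases hb0 : (b : ZMod p) = 0
  · rw [hb0, map_zero, zero_mul, add_zero] at h
    have ha0 : (a : ZMod p) = 0 := hι (by rw [map_zero]; exact h)
    exact ⟨(ZMod.intCast_zmod_eq_zero_iff_dvd a p).mp ha0, (ZMod.intCast_zmod_eq_zero_iff_dvd b p).mp hb0⟩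
  · exfalso
    set r : ZMod p := -(a : ZMod p) / (b : ZMod p) with hr
    have hθr : θ = ι r := by
      have hbF : ι (b : ZMod p) ≠ 0 := fun e => hb0 (hι (by rw [map_zero]; exact e))
      rw [hr, map_div₀, map_neg]
      field_simp
      linear_combination h
    apply hno r
    apply hι
    have e := hθ
    rw [hθr] at e
    have hu : (u : F) = ι (u : ZMod p) := by simp
    have hv : (v : F) = ι (v : ZMod p) := by simp
    rw [hu, hv, ← map_mul, ← map_mul, ← map_add] at e
    exact e

/-- **The packaged finite certificate.**  `X² = uX + v` with no integer root and no root modulo the prime `p`; `θ` a root in a field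
`F` of characteristic `p`, `t` a root in a field `K` of characteristic `0`.  If the pencil rows of `𝒜` at `θ` are independent over `F`,
then the pencil rows of `𝒜` at `t` are independent over `K`. -/
theorem linearIndependent_pencil_quad_of_finite_certificate (𝒜 : Finset (Finset α)) (u v : ℤ) (p : ℕ) [Fact p.Prime]
    (hnoZ : ∀ n : ℤ, n * n ≠ u * n + v) (hnoP : ∀ r : ZMod p, r * r ≠ (u : ZMod p) * r + (v : ZMod p))
    {F : Type*} [Field F] [CharP F p] {θ : F} (hθ : θ * θ = (u : F) * θ + (v : F))
    (hF : LinearIndependent F (fun A : 𝒜 => fun E : (𝒜 \\ 𝒜 : Finset (Finset α)) =>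
      (if (E : Finset α) ⊆ (A : Finset α) then (1 : F) else 0) +
        θ * (if Disjoint (E : Finset α) (A : Finset α) then (1 : F) else 0)))
    {K : Type*} [Field K] [CharZero K] {t : K} (ht : t * t = (u : K) * t + (v : K)) :
    LinearIndependent K (fun A : 𝒜 => fun E : (𝒜 \\ 𝒜 : Finset (Finset α)) =>
      (if (E : Finset α) ⊆ (A : Finset α) then (1 : K) else 0) +
        t * (if Disjoint (E : Finset α) (A : Finset α) then (1 : K) else 0)) :=
  linearIndependent_pencil_quad_of_reduction 𝒜 u v (Fact.out : p.Prime).one_lt hθ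
    (dvd_of_quad_no_root_mod p u v hθ hnoP) hF ht (int_indep_of_quad_no_int_root u v ht hnoZ)

/-- No integer root of `X² = uX + v` from a bound: if every root would satisfy `|n| ≤ B` and none of those works. (Helper.) -/
private theorem quad_no_int_root_of_bound (u v : ℤ) (B : ℕ)
    (hB : ∀ n : ℤ, n * n = u * n + v → n.natAbs ≤ B) (hcheck : ∀ n : ℤ, n.natAbs ≤ B → n * n ≠ u * n + v) :
    ∀ n : ℤ, n * n ≠ u * n + v :=
  fun n h => hcheck n (hB n h) h

/-- `X² = 2·X + 1` has no root modulo 3 (finite check). -/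
private theorem noRootMod_silver_of_charThree : ∀ r : ZMod 3, r * r ≠ ((2 : ℤ) : ZMod 3) * r + ((1 : ℤ) : ZMod 3) := by
  decide

/-- Silver ratio `t² = 2t + 1`, certificate over `𝔽₉` (`X² + X + 2` irreducible mod 3). -/
theorem linearIndependent_pencil_silver_of_charThree (𝒜 : Finset (Finset α))
    {F : Type*} [Field F] [CharP F 3] {θ : F} (hθ : θ * θ = 2 * θ + 1)
    (hF : LinearIndependent F (fun A : 𝒜 => fun E : (𝒜 \\ 𝒜 : Finset (Finset α)) =>
      (if (E : Finset α) ⊆ (A : Finset α) then (1 : F) else 0) +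
        θ * (if Disjoint (E : Finset α) (A : Finset α) then (1 : F) else 0)))
    {K : Type*} [Field K] [CharZero K] {t : K} (ht : t * t = 2 * t + 1) :
    LinearIndependent K (fun A : 𝒜 => fun E : (𝒜 \\ 𝒜 : Finset (Finset α)) =>
      (if (E : Finset α) ⊆ (A : Finset α) then (1 : K) else 0) +
        t * (if Disjoint (E : Finset α) (A : Finset α) then (1 : K) else 0)) := by
  haveI : Fact (Nat.Prime 3) := ⟨by norm_num⟩
  refine linearIndependent_pencil_quad_of_finite_certificate 𝒜 2 1 3 ?_ noRootMod_silver_of_charThree (by push_cast; exact hθ) hF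
    (by push_cast; exact ht)
  intro n h
  have h1 : (n - 1) * (n - 1) = 2 := by linear_combination h
  have hb : n - 1 ≤ 1 ∧ -1 ≤ n - 1 := by constructor <;> nlinarith
  have : n = 0 ∨ n = 1 ∨ n = 2 := by omega
  rcases this with rfl | rfl | rfl <;> norm_num at h1

/-- `X² = 3·X + (-1)` has no root modulo 2 (finite check). -/
private theorem noRootMod_phiSq_of_charTwo : ∀ r : ZMod 2, r * r ≠ ((3 : ℤ) : ZMod 2) * r + (((-1) : ℤ) : ZMod 2) := by
  decide

/-- `φ²`: `t² = 3t − 1`, certificate over `𝔽₄` (`X² − 3X + 1 ≡ X² + X + 1` mod 2). -/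
theorem linearIndependent_pencil_phiSq_of_charTwo (𝒜 : Finset (Finset α))
    {F : Type*} [Field F] [CharP F 2] {θ : F} (hθ : θ * θ = 3 * θ + (-1))
    (hF : LinearIndependent F (fun A : 𝒜 => fun E : (𝒜 \\ 𝒜 : Finset (Finset α)) =>
      (if (E : Finset α) ⊆ (A : Finset α) then (1 : F) else 0) +
        θ * (if Disjoint (E : Finset α) (A : Finset α) then (1 : F) else 0)))
    {K : Type*} [Field K] [CharZero K] {t : K} (ht : t * t = 3 * t + (-1)) :
    LinearIndependent K (fun A : 𝒜 => fun E : (𝒜 \\ 𝒜 : Finset (Finset α)) =>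
      (if (E : Finset α) ⊆ (A : Finset α) then (1 : K) else 0) +
        t * (if Disjoint (E : Finset α) (A : Finset α) then (1 : K) else 0)) := by
  haveI : Fact (Nat.Prime 2) := ⟨by norm_num⟩
  refine linearIndependent_pencil_quad_of_finite_certificate 𝒜 3 (-1) 2 ?_ noRootMod_phiSq_of_charTwo (by push_cast; exact hθ) hF
    (by push_cast; exact ht)
  intro n h
  have h1 : (2 * n - 3) * (2 * n - 3) = 5 := by linear_combination 4 * h
  have hb : 2 * n - 3 ≤ 2 ∧ -2 ≤ 2 * n - 3 := by constructor <;> nlinarith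
  have : n = 1 ∨ n = 2 := by omega
  rcases this with rfl | rfl <;> norm_num at h1

/-- `X² = 3·X + (-1)` has no root modulo 3 (finite check). -/
private theorem noRootMod_phiSq_of_charThree : ∀ r : ZMod 3, r * r ≠ ((3 : ℤ) : ZMod 3) * r + (((-1) : ℤ) : ZMod 3) := by
  decide

/-- `φ²`: `t² = 3t − 1`, certificate over `𝔽₉` (`X² − 3X + 1 ≡ X² + 1` mod 3). -/
theorem linearIndependent_pencil_phiSq_of_charThree (𝒜 : Finset (Finset α))
    {F : Type*} [Field F] [CharP F 3] {θ : F} (hθ : θ * θ = 3 * θ + (-1))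
    (hF : LinearIndependent F (fun A : 𝒜 => fun E : (𝒜 \\ 𝒜 : Finset (Finset α)) =>
      (if (E : Finset α) ⊆ (A : Finset α) then (1 : F) else 0) +
        θ * (if Disjoint (E : Finset α) (A : Finset α) then (1 : F) else 0)))
    {K : Type*} [Field K] [CharZero K] {t : K} (ht : t * t = 3 * t + (-1)) :
    LinearIndependent K (fun A : 𝒜 => fun E : (𝒜 \\ 𝒜 : Finset (Finset α)) =>
      (if (E : Finset α) ⊆ (A : Finset α) then (1 : K) else 0) +
        t * (if Disjoint (E : Finset α) (A : Finset α) then (1 : K) else 0)) := by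
  haveI : Fact (Nat.Prime 3) := ⟨by norm_num⟩
  refine linearIndependent_pencil_quad_of_finite_certificate 𝒜 3 (-1) 3 ?_ noRootMod_phiSq_of_charThree (by push_cast; exact hθ) hF
    (by push_cast; exact ht)
  intro n h
  have h1 : (2 * n - 3) * (2 * n - 3) = 5 := by linear_combination 4 * h
  have hb : 2 * n - 3 ≤ 2 ∧ -2 ≤ 2 * n - 3 := by constructor <;> nlinarith
  have : n = 1 ∨ n = 2 := by omega
  rcases this with rfl | rfl <;> norm_num at h1

/-- `X² = 0·X + (-1)` has no root modulo 3 (finite check). -/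
private theorem noRootMod_imagUnit_of_charThree : ∀ r : ZMod 3, r * r ≠ ((0 : ℤ) : ZMod 3) * r + (((-1) : ℤ) : ZMod 3) := by
  decide

/-- The imaginary unit `t² = −1`, certificate over `𝔽₉` (`X² + 1` irreducible mod 3). -/
theorem linearIndependent_pencil_imagUnit_of_charThree (𝒜 : Finset (Finset α))
    {F : Type*} [Field F] [CharP F 3] {θ : F} (hθ : θ * θ = -1)
    (hF : LinearIndependent F (fun A : 𝒜 => fun E : (𝒜 \\ 𝒜 : Finset (Finset α)) =>
      (if (E : Finset α) ⊆ (A : Finset α) then (1 : F) else 0) +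
        θ * (if Disjoint (E : Finset α) (A : Finset α) then (1 : F) else 0)))
    {K : Type*} [Field K] [CharZero K] {t : K} (ht : t * t = -1) :
    LinearIndependent K (fun A : 𝒜 => fun E : (𝒜 \\ 𝒜 : Finset (Finset α)) =>
      (if (E : Finset α) ⊆ (A : Finset α) then (1 : K) else 0) +
        t * (if Disjoint (E : Finset α) (A : Finset α) then (1 : K) else 0)) := by
  haveI : Fact (Nat.Prime 3) := ⟨by norm_num⟩
  refine linearIndependent_pencil_quad_of_finite_certificate 𝒜 0 (-1) 3 ?_ noRootMod_imagUnit_of_charThree (by push_cast; linear_combination hθ) hF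
    (by push_cast; linear_combination ht)
  intro n h
  nlinarith [mul_self_nonneg n]

/-- `X² = 5·X + (-1)` has no root modulo 2 (finite check). -/
private theorem noRootMod_sqrt21_of_charTwo : ∀ r : ZMod 2, r * r ≠ ((5 : ℤ) : ZMod 2) * r + (((-1) : ℤ) : ZMod 2) := by
  decide

/-- `(5 ± √21)/2`: `t² = 5t − 1`, certificate over `𝔽₄` (`X² − 5X + 1 ≡ X² + X + 1` mod 2). -/
theorem linearIndependent_pencil_sqrt21_of_charTwo (𝒜 : Finset (Finset α))
    {F : Type*} [Field F] [CharP F 2] {θ : F} (hθ : θ * θ = 5 * θ + (-1))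
    (hF : LinearIndependent F (fun A : 𝒜 => fun E : (𝒜 \\ 𝒜 : Finset (Finset α)) =>
      (if (E : Finset α) ⊆ (A : Finset α) then (1 : F) else 0) +
        θ * (if Disjoint (E : Finset α) (A : Finset α) then (1 : F) else 0)))
    {K : Type*} [Field K] [CharZero K] {t : K} (ht : t * t = 5 * t + (-1)) :
    LinearIndependent K (fun A : 𝒜 => fun E : (𝒜 \\ 𝒜 : Finset (Finset α)) =>
      (if (E : Finset α) ⊆ (A : Finset α) then (1 : K) else 0) +
        t * (if Disjoint (E : Finset α) (A : Finset α) then (1 : K) else 0)) := by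
  haveI : Fact (Nat.Prime 2) := ⟨by norm_num⟩
  refine linearIndependent_pencil_quad_of_finite_certificate 𝒜 5 (-1) 2 ?_ noRootMod_sqrt21_of_charTwo (by push_cast; exact hθ) hF
    (by push_cast; exact ht)
  intro n h
  have h1 : (2 * n - 5) * (2 * n - 5) = 21 := by linear_combination 4 * h
  have hb : 2 * n - 5 ≤ 4 ∧ -4 ≤ 2 * n - 5 := by constructor <;> nlinarith
  have : n = 1 ∨ n = 2 ∨ n = 3 ∨ n = 4 := by omega
  rcases this with rfl | rfl | rfl | rfl <;> norm_num at h1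

/-- `X² = 4·X + (-1)` has no root modulo 5 (finite check). -/
private theorem noRootMod_twoSqrt3_of_charFive : ∀ r : ZMod 5, r * r ≠ ((4 : ℤ) : ZMod 5) * r + (((-1) : ℤ) : ZMod 5) := by
  decide

/-- `2 ± √3`: `t² = 4t − 1`, certificate over `𝔽₂₅` (`X² − 4X + 1 ≡ X² + X + 1` mod 5; modulo 2 and 3 this class REDUCES to `t̄ = ∓1`,
so `p = 5` is its first certificate prime). -/
theorem linearIndependent_pencil_twoSqrt3_of_charFive (𝒜 : Finset (Finset α))
    {F : Type*} [Field F] [CharP F 5] {θ : F} (hθ : θ * θ = 4 * θ + (-1))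
    (hF : LinearIndependent F (fun A : 𝒜 => fun E : (𝒜 \\ 𝒜 : Finset (Finset α)) =>
      (if (E : Finset α) ⊆ (A : Finset α) then (1 : F) else 0) +
        θ * (if Disjoint (E : Finset α) (A : Finset α) then (1 : F) else 0)))
    {K : Type*} [Field K] [CharZero K] {t : K} (ht : t * t = 4 * t + (-1)) :
    LinearIndependent K (fun A : 𝒜 => fun E : (𝒜 \\ 𝒜 : Finset (Finset α)) =>
      (if (E : Finset α) ⊆ (A : Finset α) then (1 : K) else 0) +
        t * (if Disjoint (E : Finset α) (A : Finset α) then (1 : K) else 0)) := by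
  haveI : Fact (Nat.Prime 5) := ⟨by norm_num⟩
  refine linearIndependent_pencil_quad_of_finite_certificate 𝒜 4 (-1) 5 ?_ noRootMod_twoSqrt3_of_charFive (by push_cast; exact hθ) hF
    (by push_cast; exact ht)
  intro n h
  have h1 : (n - 2) * (n - 2) = 3 := by linear_combination h
  have hb : n - 2 ≤ 1 ∧ -1 ≤ n - 2 := by constructor <;> nlinarith
  have : n = 1 ∨ n = 2 ∨ n = 3 := by omega
  rcases this with rfl | rfl | rfl <;> norm_num at h1

/-- `X² = (-1)·X + (-1)` has no root modulo 2 (finite check). -/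
private theorem noRootMod_cubeRootUnity_of_charTwo : ∀ r : ZMod 2, r * r ≠ (((-1) : ℤ) : ZMod 2) * r + (((-1) : ℤ) : ZMod 2) := by
  decide

/-- `ζ₃` (and `ζ₆` by `t ↦ −t`): `t² = −t − 1`, certificate over `𝔽₄`. -/
theorem linearIndependent_pencil_cubeRootUnity_of_charTwo (𝒜 : Finset (Finset α))
    {F : Type*} [Field F] [CharP F 2] {θ : F} (hθ : θ * θ = (-1) * θ + (-1))
    (hF : LinearIndependent F (fun A : 𝒜 => fun E : (𝒜 \\ 𝒜 : Finset (Finset α)) =>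
      (if (E : Finset α) ⊆ (A : Finset α) then (1 : F) else 0) +
        θ * (if Disjoint (E : Finset α) (A : Finset α) then (1 : F) else 0)))
    {K : Type*} [Field K] [CharZero K] {t : K} (ht : t * t = (-1) * t + (-1)) :
    LinearIndependent K (fun A : 𝒜 => fun E : (𝒜 \\ 𝒜 : Finset (Finset α)) =>
      (if (E : Finset α) ⊆ (A : Finset α) then (1 : K) else 0) +
        t * (if Disjoint (E : Finset α) (A : Finset α) then (1 : K) else 0)) := by
  haveI : Fact (Nat.Prime 2) := ⟨by norm_num⟩
  refine linearIndependent_pencil_quad_of_finite_certificate 𝒜 (-1) (-1) 2 ?_ noRootMod_cubeRootUnity_of_charTwo (by push_cast; exact hθ) hF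
    (by push_cast; exact ht)
  intro n h
  nlinarith [mul_self_nonneg (2 * n + 1)]

/-- `X² = 1·X + (-1)` has no root modulo 2 (finite check). -/
private theorem noRootMod_sixthRootUnity_of_charTwo : ∀ r : ZMod 2, r * r ≠ ((1 : ℤ) : ZMod 2) * r + (((-1) : ℤ) : ZMod 2) := by
  decide

/-- `ζ₆`: `t² = t − 1`, certificate over `𝔽₄`. -/
theorem linearIndependent_pencil_sixthRootUnity_of_charTwo (𝒜 : Finset (Finset α))
    {F : Type*} [Field F] [CharP F 2] {θ : F} (hθ : θ * θ = 1 * θ + (-1))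
    (hF : LinearIndependent F (fun A : 𝒜 => fun E : (𝒜 \\ 𝒜 : Finset (Finset α)) =>
      (if (E : Finset α) ⊆ (A : Finset α) then (1 : F) else 0) +
        θ * (if Disjoint (E : Finset α) (A : Finset α) then (1 : F) else 0)))
    {K : Type*} [Field K] [CharZero K] {t : K} (ht : t * t = 1 * t + (-1)) :
    LinearIndependent K (fun A : 𝒜 => fun E : (𝒜 \\ 𝒜 : Finset (Finset α)) =>
      (if (E : Finset α) ⊆ (A : Finset α) then (1 : K) else 0) +
        t * (if Disjoint (E : Finset α) (A : Finset α) then (1 : K) else 0)) := by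
  haveI : Fact (Nat.Prime 2) := ⟨by norm_num⟩
  refine linearIndependent_pencil_quad_of_finite_certificate 𝒜 1 (-1) 2 ?_ noRootMod_sixthRootUnity_of_charTwo (by push_cast; exact hθ) hF
    (by push_cast; exact ht)
  intro n h
  nlinarith [mul_self_nonneg (2 * n - 1)]

end OrderedDifferences

end Summit.CriticalPhenomena.PercolationContinuityZ3.Theorems
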